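import Literature.NumberTheory.EllipticCurves.IwasawaTwistModP
import HarnessLib

/-!
# The norm element of `𝔽_p[T]/(T^{p^m})` over `𝔽_p[T]/(T^{p^n})`: `Σ_{j<p^k} (1+T)^{j p^n} = T^{p^{n+k} − p^n}`

Topic `NumberTheory/EllipticCurves` (companion of `IwasawaTwistModP`); namespace
`Literature.NumberTheory.EllipticCurves`.  Cell `bsd-smallim` (rung K6 of `BirchSwinnertonDyer`,
crux `MuTransferX9` = item 19276), seat `bsd-smallim-k6-ty` (typer): the characteristic-`p` identity
behind the Shapiro-dictionary entry "`res_{K_n → K_m} ↔ T^{p^m − p^n}`-embedding": the norm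
`N_{K_m/K_n} = Σ_{σ ∈ Gal(K_m/K_n)} σ` acts on `𝒯_{p^m} = M ⊗ 𝔽_p[T]/(T^{p^m})` as
`Σ_{j<p^{m−n}} (1+S)^{j p^n} = S^{p^m − p^n}` (`(1+T)^{p^n} = 1 + T^{p^n}` and
`Σ_{j<q} (1+Y)^j = ((1+Y)^q − 1)/Y = Y^{q−1}` in `𝔽_p[Y]` for `q = p^k`).  PROOFS only; no fact.

* `geom_sum_one_add_eq_pow` — in any ring `R` with `p = 0`: `Σ_{j<p^k} (1+Y)^j = Y^{p^k − 1}`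
  (proved in `𝔽_p[X]` by cancelling `X`, lifted through `ℤ[X] → R`).
* **`sum_unipotentPow_mul_prime_pow`**: on `Fin J → M` with `p M = 0`,
  `Σ_{j<p^k} (1+S)^{j p^n} = S^{p^{n+k} − p^n}`.

## References

* L. Washington, *Introduction to Cyclotomic Fields* (1997), §13.1–§13.2 (the norm / `ν_{n,m}`
  elements `((1+T)^{p^m} − 1)/((1+T)^{p^n} − 1)` of `Λ`). [Washington1997]
-/

noncomputable section

open Finset Polynomial

universe u

namespace Literature.NumberTheory.EllipticCurves

/-- **`Σ_{j<p^k} (1+Y)^j = Y^{p^k−1}` in a ring with `p = 0`** (`Σ_{j<q}(1+Y)^j = ((1+Y)^q − 1)/Y` and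
`(1+Y)^q = 1 + Y^q` for `q = p^k`; proved in `𝔽_p[X]`, where `X` can be cancelled, and transported
along `ℤ[X] → R`, `X ↦ Y`, the difference having coefficients divisible by `p`).
[cite: Washington1997, §13.1–§13.2] -/
theorem geom_sum_one_add_eq_pow {p : ℕ} (hp : p.Prime) {R : Type u} [Ring R] (hR : (p : R) = 0)
    (Y : R) (k : ℕ) : ∑ j ∈ range (p ^ k), (1 + Y) ^ j = Y ^ (p ^ k - 1) := by
  haveI := Fact.mk hp
  have hq : 0 < p ^ k := pow_pos hp.pos k
  -- the identity in `𝔽_p[X]`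
  have h1 : (∑ j ∈ range (p ^ k), (1 + X) ^ j : (ZMod p)[X]) = X ^ (p ^ k - 1) := by
    apply mul_right_cancel₀ (X_ne_zero (R := ZMod p))
    rw [← pow_succ, Nat.sub_add_cancel hq]
    have h := geom_sum_mul (1 + X : (ZMod p)[X]) (p ^ k)
    rw [add_sub_cancel_left] at h
    rw [h, add_pow_char_pow, one_pow, add_sub_cancel_left]
  -- lift to `ℤ[X]`
  set P : ℤ[X] := ∑ j ∈ range (p ^ k), (1 + X) ^ j - X ^ (p ^ k - 1) with hP
  have h2 : P ∈ RingHom.ker (mapRingHom (Int.castRingHom (ZMod p))) := by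
    rw [RingHom.mem_ker, coe_mapRingHom, hP, Polynomial.map_sub, Polynomial.map_sum, Polynomial.map_pow,
      Polynomial.map_X, sub_eq_zero, ← h1]
    refine Finset.sum_congr rfl fun j _ ↦ ?_
    rw [Polynomial.map_pow, Polynomial.map_add, Polynomial.map_one, Polynomial.map_X]
  rw [ker_mapRingHom, ZMod.ker_intCastRingHom, Ideal.map_span, Set.image_singleton] at h2
  obtain ⟨Q, hQ⟩ := Ideal.mem_span_singleton'.1 h2
  -- evaluate at `Y`
  let ε : ℤ[X] →+* R :=
    eval₂RingHom' (Int.castRingHom R) Y fun a ↦ (Commute.intCast_left : Commute ((a : ℤ) : R) Y)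
  have h3 : ε P = 0 := by
    rw [← hQ, map_mul]
    change _ * eval₂ (Int.castRingHom R) Y (C (p : ℤ)) = 0
    rw [eval₂_C, eq_intCast, Int.cast_natCast, hR, mul_zero]
  have h4 : ε P = ∑ j ∈ range (p ^ k), (1 + Y) ^ j - Y ^ (p ^ k - 1) := by
    rw [hP, map_sub, map_sum, map_pow]
    change ∑ j ∈ range (p ^ k), ε ((1 + X) ^ j) - eval₂ (Int.castRingHom R) Y X ^ (p ^ k - 1) = _
    rw [eval₂_X]
    refine congrArg₂ _ (Finset.sum_congr rfl fun j _ ↦ ?_) rfl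
    rw [map_pow, map_add, map_one]
    change (1 + eval₂ (Int.castRingHom R) Y X) ^ j = _
    rw [eval₂_X]
  rw [h4] at h3
  exact sub_eq_zero.1 h3

variable {M : Type u} [AddCommGroup M] {p : ℕ} [Fact p.Prime]

/-- **The norm element**: on `Fin J → M` with `p M = 0`, `Σ_{j<p^k} (1+S)^{j p^n} = S^{p^{n+k} − p^n}`
(`(1+S)^{p^n} = 1 + S^{p^n}`, then `geom_sum_one_add_eq_pow` with `Y = S^{p^n}`).  This is the action
of `N_{K_{n+k}/K_n} = Σ_{j<p^k} γ^{j p^n}` on `𝒯_J`, i.e. `ν_{n,n+k} ≡ T^{p^{n+k} − p^n} (mod p)`.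
[cite: Washington1997, §13.1–§13.2] -/
theorem sum_unipotentPow_mul_prime_pow (hM : ∀ x : M, p • x = 0) (J n k : ℕ) :
    ∑ j ∈ range (p ^ k), unipotentPow M J (j * p ^ n) = shiftEnd M J ^ (p ^ (n + k) - p ^ n) := by
  have hR : ((p : ℕ) : Module.End ℤ (Fin J → M)) = 0 := by
    refine LinearMap.ext fun x => funext fun i => ?_
    rw [Module.End.natCast_apply, LinearMap.zero_apply, Pi.smul_apply, Pi.zero_apply, hM]
  have hstep : ∀ j, unipotentPow M J (j * p ^ n) = (1 + shiftEnd M J ^ p ^ n) ^ j := fun j ↦ by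
    rw [unipotentPow, mul_comm, pow_mul, one_add_pow_prime_pow_of_natCast_eq_zero (Fact.out : p.Prime) hR]
  simp_rw [hstep]
  rw [geom_sum_one_add_eq_pow (Fact.out : p.Prime) hR, ← pow_mul]
  congr 1
  rw [Nat.mul_sub_one, ← pow_add]

end Literature.NumberTheory.EllipticCurves

end
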